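import Literature.Geometry.GaugeTheory.AsdConnectionFlatModel
import Mathlib.Geometry.Manifold.ContMDiff.NormedSpace
import HarnessLib

/-!
# Gauge invariance of the curvature density and of anti-self-duality (two-patch model over
# flat `ℝ⁴`)

Topic `Literature/Geometry/GaugeTheory`; companion *proofs* file (theorems only: no definition, no
named fact) of `AsdModuliSpace.lean` and `AsdConnectionFlatModel.lean`. `AsdModuliSpace.lean`
defines the curvature density of a CLASS `[A] ∈ M_k(X, g)` as the density of a chosen
representative and records, without proof, that "gauge invariance of `ρ_A` (`F ↦ u⁻¹ F u`
preserves `|·|`) makes this independent of the representative". Over the base `X = ℝ⁴` modelled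
on itself (charts = identity, where the chart-wise calculus of the model is ordinary calculus,
`AsdConnectionFlatModel.lean`) we prove it:

* `QuatOneForm.mul_extDeriv_add_bracket_eq` — the common core: if `g A'(w) = A(w) g + ∂_w g`
  near `x` for smooth `A, A', g`, then `g F_{A'} = F_A g` at `x`, `F_B := dB + B ∧ B`
  (differentiate, antisymmetrise, use the symmetry of `D²g`);
* `SpOneConnection.mul_curvature_of_act`, `SpOneConnection.curvature_eq_conj_of_act` — **the
  curvature transforms by conjugation under a gauge transformation**: if `B = u⁻¹ A u + u⁻¹ du`
  patchwise then `F_B = u⁻¹ F_A u` patchwise (Labastida–Mariño 2005, §2.1 after (2.4):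
  `F_A ↦ u⁻¹ F_A u`; Naber 1997, (5.2.4); Donaldson–Kronheimer 1990, §2.1);
* `SpOneConnection.curvatureDensity_eq_of_gaugeRel`, `SpOneConnection.IsASD.of_gaugeRel` — hence
  the curvature density `ρ = |F|²_g` (any metric `g`) and anti-self-duality are gauge invariant
  (Naber 1997, §5.3: "`‖F^g(q)‖² = ‖F(q)‖²` … gauge invariant"; Labastida–Mariño 2005, (2.17):
  the ASD condition is gauge invariant);
* `AsdModuliSpace.density_mk` — consequently the density of the class of `A` in
  `M_k(ℝ⁴, g)` IS `ρ_A` (the representative chosen by `Quot.out` is related to `A` by the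
  equivalence closure of gauge equivalence, along which `ρ` is constant).

## References

* J. Labastida, M. Mariño, *Topological Quantum Field Theory and Four Manifolds* (2005), §2.1,
  (2.3)–(2.4), (2.17). [LabastidaMarino2005]
* G. L. Naber, *Topology, Geometry, and Gauge Fields* (1997), §5.2, (5.2.4); §5.3 (gauge
  invariance of `‖F(q)‖²`). [Naber1997]
* S. K. Donaldson, P. B. Kronheimer, *The Geometry of Four-Manifolds* (1990), §2.1.
  [DonaldsonKronheimer1990]
-/

noncomputable section

open scoped Manifold ContDiff Topology Quaternion
open Set Function Filter
open Literature.Geometry.Lorentzian (PseudoRiemannianMetric)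
open Literature.Topology.FourManifolds (SmoothOrientation)

namespace Literature.Geometry.GaugeTheory

/-! ### The core computation: `g A' = A g + dg` forces `g F_{A'} = F_A g` -/

namespace QuatOneForm

/-- **Conjugation law for `dA + A ∧ A` from the gluing / gauge law.** Over flat `ℝ⁴`, let
`A, A'` be local connection forms and `g` an `ℍ`-valued function, all `C^∞` at `x`, with
`g(y) A'(y)(w) = A(y)(w) g(y) + ∂_w g(y)` for all `w` and all `y` near `x`. Then at `x`, for all
`u, v`: `g · (dA'(u,v) + [A'(u), A'(v)]) = (dA(u,v) + [A(u), A(v)]) · g`. Proof: differentiate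
the relation in the direction `u`, antisymmetrise in `(u, v)` (the second derivatives of `g`
cancel by symmetry), and use the relation once more on the first-order terms. This is the
computation behind `F ↦ u⁻¹ F u` (Labastida–Mariño 2005, §2.1; Naber 1997, (5.2.4)).
[cite: LabastidaMarino2005, §2.1 (2.3)–(2.4)] -/
theorem mul_extDeriv_add_bracket_eq {A A' : QuatOneForm (EuclideanSpace ℝ (Fin 4))}
    {g : EuclideanSpace ℝ (Fin 4) → ℍ} {x : EuclideanSpace ℝ (Fin 4)}
    (hA : ContDiffAt (F := EuclideanSpace ℝ (Fin 4) →L[ℝ] ℍ) ℝ ∞ A x)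
    (hA' : ContDiffAt (F := EuclideanSpace ℝ (Fin 4) →L[ℝ] ℍ) ℝ ∞ A' x)
    (hg : ContDiffAt ℝ ∞ g x)
    (hrel : ∀ᶠ y in 𝓝 x, ∀ w : EuclideanSpace ℝ (Fin 4), g y * A' y w = A y w * g y + fderiv ℝ g y w)
    (u v : EuclideanSpace ℝ (Fin 4)) :
    g x * (A'.extDeriv x u v + (A' x u * A' x v - A' x v * A' x u)) =
      (A.extDeriv x u v + (A x u * A x v - A x v * A x u)) * g x := by
  have hgd : DifferentiableAt ℝ g x := hg.differentiableAt (by simp)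
  have hAd := hA.differentiableAt (by simp)
  have hA'd := hA'.differentiableAt (by simp)
  have ha : ∀ w, DifferentiableAt ℝ (fun y ↦ A' y w) x := fun w ↦
    hA'd.clm_apply (differentiableAt_const w)
  have hb : ∀ w, DifferentiableAt ℝ (fun y ↦ A y w) x := fun w ↦
    hAd.clm_apply (differentiableAt_const w)
  have hg' : ContDiffAt ℝ ∞ (fderiv ℝ g) x := hg.fderiv_right (by simp)
  have hg'd : DifferentiableAt ℝ (fderiv ℝ g) x := hg'.differentiableAt (by simp)
  have h2 : minSmoothness ℝ 2 ≤ ∞ := by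
    have h : ((2 : ℕ) : ℕ∞ω) ≤ ∞ := ENat.natCast_le_of_coe_top_le_withTop le_rfl 2
    simpa using h
  -- the relation near `x`, per component, and its derivative in the direction `z`
  have hev : ∀ w, (fun y ↦ A y w * g y + fderiv ℝ g y w) =ᶠ[𝓝 x] (fun y ↦ g y * A' y w) :=
    fun w ↦ hrel.mono fun y hy ↦ (hy w).symm
  have key : ∀ w z : EuclideanSpace ℝ (Fin 4),
      g x * fderiv ℝ (fun y ↦ A' y w) x z =
        fderiv ℝ (fun y ↦ A y w) x z * g x + A x w * fderiv ℝ g x z +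
          fderiv ℝ (fderiv ℝ g) x z w - fderiv ℝ g x z * A' x w := by
    intro w z
    have hL : HasFDerivAt (fun y ↦ g y * A' y w)
        (g x • fderiv ℝ (fun y ↦ A' y w) x + MulOpposite.op (A' x w) • fderiv ℝ g x) x :=
      hgd.hasFDerivAt.fun_mul' (ha w).hasFDerivAt
    have hR : HasFDerivAt (fun y ↦ A y w * g y + fderiv ℝ g y w)
        (A x w • fderiv ℝ g x + MulOpposite.op (g x) • fderiv ℝ (fun y ↦ A y w) x +
          ((fderiv ℝ g x).comp (0 : EuclideanSpace ℝ (Fin 4) →L[ℝ] EuclideanSpace ℝ (Fin 4)) +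
            (fderiv ℝ (fderiv ℝ g) x).flip w)) x :=
      ((hb w).hasFDerivAt.fun_mul' hgd.hasFDerivAt).fun_add
        (hg'd.hasFDerivAt.clm_apply (hasFDerivAt_const w x))
    have huniq := (hR.congr_of_eventuallyEq (hev w).symm).unique hL
    have hz := DFunLike.congr_fun huniq z
    simp only [_root_.add_apply, _root_.smul_apply, smul_eq_mul, op_smul_eq_mul,
      ContinuousLinearMap.comp_zero, zero_add, ContinuousLinearMap.flip_apply] at hz
    rw [eq_sub_iff_add_eq, ← hz]
    abel
  have hsym : fderiv ℝ (fderiv ℝ g) x v u = fderiv ℝ (fderiv ℝ g) x u v :=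
    (hg.isSymmSndFDerivAt h2) v u
  -- the relation at `x`
  have hx := hrel.self_of_nhds
  have Cu : fderiv ℝ g x u = g x * A' x u - A x u * g x := by rw [hx u]; abel
  have Cv : fderiv ℝ g x v = g x * A' x v - A x v * g x := by rw [hx v]; abel
  rw [A'.extDeriv_eq_fderiv hA'd u v, A.extDeriv_eq_fderiv hAd u v, mul_add, mul_sub, key v u,
    key u v, hsym, Cu, Cv]
  noncomm_ring

end QuatOneForm

/-! ### Gauge transformations over flat `ℝ⁴` -/

/-- Over flat `ℝ⁴` both patches are open (`ℝ⁴ ∖ {p}` and `ℝ⁴`). [folklore] -/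
theorem isOpen_patch (p : EuclideanSpace ℝ (Fin 4)) (i : Fin 2) : IsOpen (patch p i) := by
  fin_cases i
  · exact isOpen_compl_singleton
  · simp only [Fin.mk_one, patch_one_eq_univ, isOpen_univ]

namespace GaugeTransformation

variable {o : SmoothOrientation (𝓡 4) (EuclideanSpace ℝ (Fin 4))} {k : ℤ}
  {p : EuclideanSpace ℝ (Fin 4)}

/-- Over flat `ℝ⁴` the local representatives of a gauge transformation are `C^∞` at the points of
their patches (chart-wise smoothness is ordinary smoothness; the patches are open). [folklore] -/
theorem contDiffAt_toFun (u : GaugeTransformation o k p) {i : Fin 2}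
    {x : EuclideanSpace ℝ (Fin 4)} (hx : x ∈ patch p i) : ContDiffAt ℝ ∞ (u.toFun i) x :=
  contMDiffAt_iff_contDiffAt.1 ((u.contMDiffOn i).contMDiffAt ((isOpen_patch p i).mem_nhds hx))

/-- The local representatives of a gauge transformation do not vanish on their patches (they are
unit quaternions). [folklore] -/
theorem toFun_ne_zero (u : GaugeTransformation o k p) {i : Fin 2}
    {x : EuclideanSpace ℝ (Fin 4)} (hx : x ∈ patch p i) : u.toFun i x ≠ 0 := by
  rw [← norm_ne_zero_iff, u.norm_eq_one i x hx]
  exact one_ne_zero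

end GaugeTransformation

/-! ### The curvature under a gauge transformation -/

namespace SpOneConnection

variable {o : SmoothOrientation (𝓡 4) (EuclideanSpace ℝ (Fin 4))} {k : ℤ}
  {p : EuclideanSpace ℝ (Fin 4)}

/-- Over flat `ℝ⁴` each local connection form is `C^∞` at the points of its patch. [folklore] -/
theorem contDiffAt_form (A : SpOneConnection o k p) {i : Fin 2} {x : EuclideanSpace ℝ (Fin 4)}
    (hx : x ∈ patch p i) :
    ContDiffAt (F := EuclideanSpace ℝ (Fin 4) →L[ℝ] ℍ) ℝ ∞ (A.form i) x :=
  (A.form i).smoothAt_iff_contDiffAt.1 (A.smoothAt i x hx)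

/-- **The curvature transforms by conjugation under a gauge transformation** (over flat `ℝ⁴`):
if the local forms of `B` are the gauge transforms `uᵢ⁻¹ Aᵢ uᵢ + uᵢ⁻¹ duᵢ` of those of `A`
(Labastida–Mariño 2005, (2.4)), then `uᵢ F_{B,i} = F_{A,i} uᵢ` at every point of patch `i`
(ibid., §2.1: `F ↦ u⁻¹ F u`; Naber 1997, (5.2.4); Donaldson–Kronheimer 1990, §2.1).
[cite: LabastidaMarino2005, §2.1 (2.3)–(2.4)] -/
theorem mul_curvature_of_act (A B : SpOneConnection o k p) (u : GaugeTransformation o k p)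
    (hrel : ∀ i, ∀ y ∈ patch p i, ∀ v, B.form i y v = u.act A.form i y v) {i : Fin 2}
    {x : EuclideanSpace ℝ (Fin 4)} (hx : x ∈ patch p i) (w z : EuclideanSpace ℝ (Fin 4)) :
    u.toFun i x * B.curvature i x w z = A.curvature i x w z * u.toFun i x := by
  have hrel' : ∀ᶠ y in 𝓝 x, ∀ v : EuclideanSpace ℝ (Fin 4),
      u.toFun i y * B.form i y v = A.form i y v * u.toFun i y + fderiv ℝ (u.toFun i) y v := by
    filter_upwards [(isOpen_patch p i).mem_nhds hx] with y hy v
    have h0 : u.toFun i y ≠ 0 := u.toFun_ne_zero hy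
    rw [hrel i y hy v, GaugeTransformation.act, quatDeriv_eq_fderiv, mul_add, ← mul_assoc,
      ← mul_assoc, mul_inv_cancel₀ h0, one_mul, ← mul_assoc, mul_inv_cancel₀ h0, one_mul]
    rfl
  exact QuatOneForm.mul_extDeriv_add_bracket_eq (A.contDiffAt_form hx) (B.contDiffAt_form hx)
    (u.contDiffAt_toFun hx) hrel' w z

/-- **`F_B = u⁻¹ F_A u`** patchwise, for `B` the gauge transform of `A` by `u` (over flat `ℝ⁴`;
Labastida–Mariño 2005, §2.1). [cite: LabastidaMarino2005, §2.1 (2.3)–(2.4)] -/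
theorem curvature_eq_conj_of_act (A B : SpOneConnection o k p) (u : GaugeTransformation o k p)
    (hrel : ∀ i, ∀ y ∈ patch p i, ∀ v, B.form i y v = u.act A.form i y v) {i : Fin 2}
    {x : EuclideanSpace ℝ (Fin 4)} (hx : x ∈ patch p i) (w z : EuclideanSpace ℝ (Fin 4)) :
    B.curvature i x w z = (u.toFun i x)⁻¹ * A.curvature i x w z * u.toFun i x := by
  rw [mul_assoc, eq_inv_mul_iff_mul_eq₀ (u.toFun_ne_zero hx)]
  exact A.mul_curvature_of_act B u hrel hx w z

/-- **Gauge invariance of `|F|²_g(x)`** (over flat `ℝ⁴`, any metric `g`): gauge equivalent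
connections have the same pointwise curvature norm on each patch (Naber 1997, §5.3:
`‖F^g(q)‖² = ‖F(q)‖²`). [cite: Naber1997, §5.3] -/
theorem twoFormNormSq_curvature_eq_of_gaugeRel {A B : SpOneConnection o k p} (h : GaugeRel A B)
    (g : PseudoRiemannianMetric (𝓡 4) ∞ (EuclideanSpace ℝ (Fin 4))
      (TangentSpace (𝓡 4) : EuclideanSpace ℝ (Fin 4) → Type _))
    {i : Fin 2} {x : EuclideanSpace ℝ (Fin 4)} (hx : x ∈ patch p i) :
    twoFormNormSq g x (B.curvature i x) = twoFormNormSq g x (A.curvature i x) := by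
  obtain ⟨u, hu⟩ := h
  have h0 : u.toFun i x ≠ 0 := u.toFun_ne_zero hx
  by_cases he : ∃ e : Fin 4 → TangentSpace (𝓡 4) x, g.IsOrthonormalFrame x e
  · obtain ⟨e, he⟩ := he
    rw [twoFormNormSq_eq_six_of_isOrthonormalFrame g (B.curvature_add_left i x)
        (B.curvature_smul_left i x) (fun u v ↦ B.curvature_swap i x v u) he,
      twoFormNormSq_eq_six_of_isOrthonormalFrame g (A.curvature_add_left i x)
        (A.curvature_smul_left i x) (fun u v ↦ A.curvature_swap i x v u) he]
    simp only [A.curvature_eq_conj_of_act B u hu hx, adNormSq_conj h0]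
  · rw [twoFormNormSq_of_not_exists g _ he, twoFormNormSq_of_not_exists g _ he]

/-- **Gauge invariance of the curvature density** `ρ_A = |F_A|²_g` (over flat `ℝ⁴`, any metric
`g`): `ρ_B = ρ_A` for gauge equivalent `A, B` (Naber 1997, §5.3; Donaldson–Kronheimer 1990, §2.1).
[cite: Naber1997, §5.3] -/
theorem curvatureDensity_eq_of_gaugeRel {A B : SpOneConnection o k p} (h : GaugeRel A B)
    (g : PseudoRiemannianMetric (𝓡 4) ∞ (EuclideanSpace ℝ (Fin 4))
      (TangentSpace (𝓡 4) : EuclideanSpace ℝ (Fin 4) → Type _))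
    (x : EuclideanSpace ℝ (Fin 4)) : B.curvatureDensity g x = A.curvatureDensity g x :=
  twoFormNormSq_curvature_eq_of_gaugeRel h g (mem_patch_patchIndex p x)

/-- **Gauge invariance of anti-self-duality, frame-wise** (over flat `ℝ⁴`): for gauge equivalent
`A, B`, `F_B⁺ = 0` in a frame iff `F_A⁺ = 0` in it (Labastida–Mariño 2005, (2.17): the condition is
conjugation invariant). [cite: LabastidaMarino2005, (2.17), (2.19)] -/
theorem isASDIn_curvature_iff_of_gaugeRel {A B : SpOneConnection o k p} (h : GaugeRel A B)
    {i : Fin 2} {x : EuclideanSpace ℝ (Fin 4)} (hx : x ∈ patch p i)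
    (e : Fin 4 → TangentSpace (𝓡 4) x) :
    IsASDIn (B.curvature i x) e ↔ IsASDIn (A.curvature i x) e := by
  obtain ⟨u, hu⟩ := h
  have h0 : u.toFun i x ≠ 0 := u.toFun_ne_zero hx
  unfold IsASDIn sdComponents
  simp only [A.curvature_eq_conj_of_act B u hu hx]
  constructor
  · intro h
    have c0 := (conj_add_conj_eq_zero_iff h0 _ _).1 (congr_fun h 0)
    have c1 := (conj_add_conj_eq_zero_iff h0 _ _).1 (congr_fun h 1)
    have c2 := (conj_add_conj_eq_zero_iff h0 _ _).1 (congr_fun h 2)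
    funext j
    fin_cases j
    · exact c0
    · exact c1
    · exact c2
  · intro h
    have c0 := (conj_add_conj_eq_zero_iff h0 _ _).2 (congr_fun h 0)
    have c1 := (conj_add_conj_eq_zero_iff h0 _ _).2 (congr_fun h 1)
    have c2 := (conj_add_conj_eq_zero_iff h0 _ _).2 (congr_fun h 2)
    funext j
    fin_cases j
    · exact c0
    · exact c1
    · exact c2

/-- **Anti-self-duality is gauge invariant** (over flat `ℝ⁴`): a gauge transform of a
`g`-anti-self-dual connection is `g`-anti-self-dual (Labastida–Mariño 2005, (2.17), §2.3:
the gauge group acts on the space of ASD connections). [cite: LabastidaMarino2005, (2.17), (2.19)] -/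
theorem IsASD.of_gaugeRel {A B : SpOneConnection o k p}
    {g : PseudoRiemannianMetric (𝓡 4) ∞ (EuclideanSpace ℝ (Fin 4))
      (TangentSpace (𝓡 4) : EuclideanSpace ℝ (Fin 4) → Type _)}
    (hA : A.IsASD g) (h : GaugeRel A B) : B.IsASD g :=
  fun i x hx e he ↦ (isASDIn_curvature_iff_of_gaugeRel h hx e).2 (hA i x hx e he)

end SpOneConnection

/-! ### The density of a class is the density of any representative -/

namespace AsdModuliSpace

variable {g : PseudoRiemannianMetric (𝓡 4) ∞ (EuclideanSpace ℝ (Fin 4))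
    (TangentSpace (𝓡 4) : EuclideanSpace ℝ (Fin 4) → Type _)}
  {o : SmoothOrientation (𝓡 4) (EuclideanSpace ℝ (Fin 4))} {k : ℤ}

/-- Along the equivalence closure of gauge equivalence the curvature density is constant (it is
invariant under each gauge transformation, `curvatureDensity_eq_of_gaugeRel`). [folklore] -/
theorem curvatureDensity_eq_of_eqvGen
    {A B : AsdConnection g o k (basePoint (EuclideanSpace ℝ (Fin 4)))}
    (h : Relation.EqvGen
      (fun A B : AsdConnection g o k (basePoint (EuclideanSpace ℝ (Fin 4))) ↦ GaugeRel A.1 B.1)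
      A B) :
    A.1.curvatureDensity g = B.1.curvatureDensity g := by
  induction h with
  | rel X Y hXY => funext x; exact (SpOneConnection.curvatureDensity_eq_of_gaugeRel hXY g x).symm
  | refl X => rfl
  | symm X Y _ ih => exact ih.symm
  | trans X Y Z _ _ ih₁ ih₂ => exact ih₁.trans ih₂

/-- **The curvature density of a class is the curvature density of any of its representatives**
(over flat `ℝ⁴`): `AsdModuliSpace.density (mk A) = ρ_A`. The definition evaluates `ρ` on the
representative `Quot.out (mk A)`, which is related to `A` by the equivalence closure of gauge
equivalence, along which `ρ` is constant (Donaldson–Kronheimer 1990, §2.1: `|F_A|²` is gauge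
invariant). [cite: DonaldsonKronheimer1990, §2.1] -/
theorem density_mk (A : AsdConnection g o k (basePoint (EuclideanSpace ℝ (Fin 4)))) :
    (AsdModuliSpace.mk A).density g = A.1.curvatureDensity g := by
  have h : Relation.EqvGen
      (fun A B : AsdConnection g o k (basePoint (EuclideanSpace ℝ (Fin 4))) ↦ GaugeRel A.1 B.1)
      (AsdModuliSpace.mk A).out A :=
    Quot.eq.1 ((AsdModuliSpace.mk A).mk_out)
  funext x
  exact congr_fun (curvatureDensity_eq_of_eqvGen h) x

/-- Gauge equivalent anti-self-dual connections have classes with the same density (indeed the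
same class; stated for the density). [cite: DonaldsonKronheimer1990, §2.1] -/
theorem density_mk_eq_of_gaugeRel
    {A B : AsdConnection g o k (basePoint (EuclideanSpace ℝ (Fin 4)))} (h : GaugeRel A.1 B.1) :
    (AsdModuliSpace.mk A).density g = (AsdModuliSpace.mk B).density g := by
  rw [AsdModuliSpace.mk_eq_mk_of_gaugeRel h]

end AsdModuliSpace

end Literature.Geometry.GaugeTheory

end
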